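import Mathlib
import HarnessLib

/-!
# Crux `BarrierLever.SuccinctHittingSetsForVP` (stmt-ValiantsHypothesis-14610), line `registered` —
DIMENSION COUNT: a polynomial map from few variables has multilinear (low-degree) annihilators

Generic toolkit for the companion file `…LowDegreeEquations.lean` (equations of polynomial degree
for small circuits), kept separate by the 400-line rule. Everything here is linear algebra and
arithmetic over `ℂ`, with no circuits:

* `LowDegreeEquations.exists_ne_zero_aeval_eq_zero` / registered stub `stub_dimensionCount` :
  if `h : τ → ℂ[υ]` substitutes polynomials of total degree `≤ δ` and
  `(#τ · δ + 1) ^ #υ < 2 ^ #τ`, some NONZERO polynomial `D ∈ ℂ[τ]` of total degree `≤ #τ` has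
  `D(h) = 0` — the multilinear polynomials in `τ` (dimension `2 ^ #τ`, `nat_card_boxOne`) map
  linearly (`totalDegree_aeval_le`) into the polynomials of degree `≤ #τ δ` in `υ` (dimension
  `≤ (#τ δ + 1) ^ #υ`, `degLE_injective`), and `LinearMap.ker_ne_bot_of_finrank_lt`;
* `eval_comp_aeval` : `(D(h))(y) = D(h(y))`;
* `exists_injective_degree_eq` : `{0,1}^k` embeds into the exponent vectors of degree `k + 1` on
  `k + 1` variables;
* arithmetic: `eventually_mul_pow_le_two_pow` (`A n^k ≤ 2^n` eventually, from Mathlib's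
  `isLittleO_pow_const_const_pow_of_one_lt`), `pow_three_lt_two_pow`, `key_ineq`
  (`(p²(2n-1)+1)^p < 2^(p²)` for `p ≥ max(10, 2n)`), `two_pow_le_choose` (`2^n ≤ C(2n,n)`, `n ≥ 4`).

All folklore; axioms `propext`, `Classical.choice`, `Quot.sound`.
-/

-- layout Summits/ValiantsHypothesis/ValiantsHypothesis forces the duplicated namespace component
set_option linter.dupNamespace false

namespace Summit.ValiantsHypothesis.ValiantsHypothesis.Theorems.BarrierLever.SuccinctHittingSetsForVP

open MvPolynomial

namespace LowDegreeEquations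

/-! ### Dimension count: a polynomial map from few variables has low-degree annihilators -/

section LinAlg

variable {τ υ : Type*} [Fintype τ]

/-- Substituting polynomials of degree `≤ δ` into a polynomial of box-degree `≤ 1` (each variable
to the power `≤ 1`) yields total degree `≤ #vars · δ`. [folklore] -/
theorem totalDegree_aeval_le (h : τ → MvPolynomial υ ℂ) {δ : ℕ} (hδ : ∀ t, (h t).totalDegree ≤ δ)
    {D : MvPolynomial τ ℂ} (hD : D ∈ restrictDegree τ ℂ 1) :
    (aeval h D).totalDegree ≤ Fintype.card τ * δ := by
  classical
  rw [mem_restrictDegree] at hD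
  conv_lhs => rw [D.as_sum, map_sum]
  refine totalDegree_finsetSum_le fun m hm => ?_
  rw [aeval_monomial, Finsupp.prod]
  refine (totalDegree_mul _ _).trans ?_
  rw [MvPolynomial.algebraMap_eq, totalDegree_C, zero_add]
  refine (totalDegree_finsetProd _ _).trans ?_
  calc ∑ i ∈ m.support, (h i ^ m i).totalDegree
      ≤ ∑ i ∈ m.support, δ := Finset.sum_le_sum fun i _ =>
        (totalDegree_pow _ _).trans (by
          calc m i * (h i).totalDegree ≤ 1 * δ := Nat.mul_le_mul (hD m hm i) (hδ i)
            _ = δ := one_mul δ)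
    _ = m.support.card * δ := by rw [Finset.sum_const, smul_eq_mul]
    _ ≤ Fintype.card τ * δ := Nat.mul_le_mul_right _ (Finset.card_le_univ _)

/-- A polynomial of box-degree `≤ 1` has total degree `≤ #vars`. [folklore] -/
theorem totalDegree_le_card_of_mem_restrictDegree_one {D : MvPolynomial τ ℂ}
    (hD : D ∈ restrictDegree τ ℂ 1) : D.totalDegree ≤ Fintype.card τ := by
  classical
  rw [mem_restrictDegree] at hD
  refine Finset.sup_le fun m hm => ?_
  calc (m.sum fun _ e => e) = ∑ i ∈ m.support, m i := rfl
    _ ≤ ∑ i ∈ m.support, 1 := Finset.sum_le_sum fun i _ => hD m hm i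
    _ = m.support.card := by rw [Finset.sum_const, smul_eq_mul, mul_one]
    _ ≤ Fintype.card τ := Finset.card_le_univ _

/-- The exponent vectors of box-degree `≤ 1` on `τ` are in bijection with `τ → Fin 2`, so
there are `2 ^ #τ` of them. [folklore] -/
theorem nat_card_boxOne (τ : Type*) [Fintype τ] :
    Nat.card ({m : τ →₀ ℕ | ∀ i, m i ≤ 1} : Set (τ →₀ ℕ)) = 2 ^ Fintype.card τ := by
  classical
  let e : ({m : τ →₀ ℕ | ∀ i, m i ≤ 1} : Set (τ →₀ ℕ)) ≃ (τ → Fin 2) :=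
    { toFun := fun m i => ⟨m.1 i, Nat.lt_succ_of_le (m.2 i)⟩
      invFun := fun g => ⟨Finsupp.equivFunOnFinite.symm fun i => (g i : ℕ), fun i => by
        have := (g i).isLt
        show Finsupp.equivFunOnFinite.symm (fun i => ((g i : Fin 2) : ℕ)) i ≤ 1
        rw [Finsupp.coe_equivFunOnFinite_symm]
        omega⟩
      left_inv := fun m => by
        apply Subtype.ext
        ext i
        simp
      right_inv := fun g => by
        funext i
        apply Fin.ext
        simp }
  rw [Nat.card_congr e, Nat.card_fun]
  simp [Nat.card_eq_fintype_card]

/-- The exponent vectors of total degree `≤ d` on `υ` inject into `υ → Fin (d + 1)`. [folklore] -/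
theorem degLE_injective (υ : Type*) [Fintype υ] (d : ℕ) :
    Function.Injective (fun m : ({m : υ →₀ ℕ | (m.sum fun _ e => e) ≤ d} : Set (υ →₀ ℕ)) =>
      fun i => (⟨m.1 i, Nat.lt_succ_of_le ((Finsupp.le_degree i m.1).trans m.2)⟩ : Fin (d + 1))) := by
  intro m m' h
  apply Subtype.ext
  ext i
  have := congrFun h i
  simpa using this

/-- **Dimension count.** If `h : τ → ℂ[υ]` substitutes polynomials of degree `≤ δ` and
`(#τ · δ + 1) ^ #υ < 2 ^ #τ`, then some NONZERO polynomial `D` of box-degree `≤ 1` (hence total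
degree `≤ #τ`) is annihilated: `D(h) = 0` — the multilinear polynomials in `τ` (dimension `2^#τ`)
map linearly into the polynomials of degree `≤ #τ δ` in `υ` (dimension `≤ (#τ δ + 1)^#υ`).
[folklore] -/
theorem exists_ne_zero_aeval_eq_zero [Fintype υ] (h : τ → MvPolynomial υ ℂ) {δ : ℕ}
    (hδ : ∀ t, (h t).totalDegree ≤ δ)
    (hcard : (Fintype.card τ * δ + 1) ^ Fintype.card υ < 2 ^ Fintype.card τ) :
    ∃ D : MvPolynomial τ ℂ, D ≠ 0 ∧ D.totalDegree ≤ Fintype.card τ ∧ aeval h D = 0 := by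
  classical
  set d := Fintype.card τ * δ with hd
  -- source: box-degree ≤ 1; target: total degree ≤ d
  let sV : Set (τ →₀ ℕ) := {m | ∀ i, m i ≤ 1}
  let sW : Set (υ →₀ ℕ) := {m | (m.sum fun _ e => e) ≤ d}
  let V : Submodule ℂ (MvPolynomial τ ℂ) := restrictDegree τ ℂ 1
  let W : Submodule ℂ (MvPolynomial υ ℂ) := restrictTotalDegree υ ℂ d
  have hVdef : V = restrictSupport ℂ sV := rfl
  have hWdef : W = restrictSupport ℂ sW := rfl
  let bV : Module.Basis sV ℂ V := hVdef ▸ basisRestrictSupport ℂ sV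
  let bW : Module.Basis sW ℂ W := hWdef ▸ basisRestrictSupport ℂ sW
  haveI : Finite sV := Nat.finite_of_card_ne_zero (by rw [nat_card_boxOne]; positivity)
  haveI : Finite sW := Finite.of_injective _ (degLE_injective υ d)
  haveI : Module.Finite ℂ V := Module.Finite.of_basis bV
  haveI : Module.Finite ℂ W := Module.Finite.of_basis bW
  have hV : Module.finrank ℂ V = 2 ^ Fintype.card τ := by
    rw [Module.finrank_eq_nat_card_basis bV, nat_card_boxOne]
  have hW : Module.finrank ℂ W ≤ (d + 1) ^ Fintype.card υ := by
    rw [Module.finrank_eq_nat_card_basis bW]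
    have := Nat.card_le_card_of_injective _ (degLE_injective υ d)
    rw [Nat.card_fun] at this
    simpa [Nat.card_eq_fintype_card] using this
  -- the restricted substitution map
  have hmaps : ∀ v : V, aeval h (v : MvPolynomial τ ℂ) ∈ W := fun v =>
    (mem_restrictTotalDegree υ _ _).mpr (totalDegree_aeval_le h hδ v.2)
  let f : V →ₗ[ℂ] W :=
    LinearMap.codRestrict W ((aeval h).toLinearMap.comp V.subtype) hmaps
  have hlt : Module.finrank ℂ W < Module.finrank ℂ V := by
    rw [hV]; exact lt_of_le_of_lt hW hcard
  obtain ⟨v, hv, hv0⟩ := (Submodule.ne_bot_iff _).mp (LinearMap.ker_ne_bot_of_finrank_lt hlt)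
  refine ⟨v, fun h0 => hv0 (Subtype.ext h0), totalDegree_le_card_of_mem_restrictDegree_one v.2, ?_⟩
  have : (f v : MvPolynomial υ ℂ) = 0 := by
    rw [LinearMap.mem_ker] at hv
    rw [hv]; rfl
  simpa [f] using this

end LinAlg

/-- Evaluating after a substitution: `(D(h))(y) = D(h(y))`. [folklore] -/
theorem eval_comp_aeval {τ υ : Type*} (y : υ → ℂ) (h : τ → MvPolynomial υ ℂ)
    (D : MvPolynomial τ ℂ) : eval y (aeval h D) = eval (fun j => eval y (h j)) D := by
  have key : (eval y).comp (aeval h : MvPolynomial τ ℂ →ₐ[ℂ] MvPolynomial υ ℂ).toRingHom =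
      eval (fun j => eval y (h j)) :=
    MvPolynomial.ringHom_ext (fun c => by simp) (fun i => by simp)
  exact RingHom.congr_fun key D

/-! ### Many monomials of top degree -/

/-- There are at least `2 ^ (n - 1)` exponent vectors of degree exactly `n` on `n` variables:
`g ↦ (n - |g|, g₁, …, g_{n-1})` embeds `{0,1}^{n-1}`. [folklore] -/
theorem exists_injective_degree_eq (k : ℕ) :
    ∃ e : (Fin k → Fin 2) → (Fin (k + 1) →₀ ℕ), Function.Injective e ∧ ∀ g, (e g).degree = k + 1 := by
  have hsum : ∀ g : Fin k → Fin 2, ∑ i, ((g i : Fin 2) : ℕ) ≤ k := fun g =>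
    (Finset.sum_le_sum fun i _ => Nat.lt_succ_iff.mp (g i).isLt).trans (by simp)
  refine ⟨fun g => Finsupp.equivFunOnFinite.symm
      (Fin.cons (k + 1 - ∑ i, ((g i : Fin 2) : ℕ)) fun i => ((g i : Fin 2) : ℕ)), ?_, ?_⟩
  · intro g g' h
    funext i
    have := DFunLike.congr_fun h i.succ
    simp only [Finsupp.coe_equivFunOnFinite_symm, Fin.cons_succ] at this
    exact Fin.ext this
  · intro g
    rw [Finsupp.degree_eq_sum]
    simp only [Finsupp.coe_equivFunOnFinite_symm]
    rw [Fin.sum_univ_succ]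
    simp only [Fin.cons_zero, Fin.cons_succ]
    have := hsum g
    omega

/-! ### Arithmetic -/

/-- Polynomials are eventually dominated by `2 ^ n`. [folklore] -/
theorem eventually_mul_pow_le_two_pow (A k : ℕ) :
    ∃ n₀ : ℕ, ∀ n : ℕ, n₀ ≤ n → A * n ^ k ≤ 2 ^ n := by
  have h := (isLittleO_pow_const_const_pow_of_one_lt (R := ℝ) (k + 1)
    (one_lt_two : (1 : ℝ) < 2)).eventuallyLE
  obtain ⟨n₁, hn₁⟩ := Filter.eventually_atTop.mp h
  refine ⟨max n₁ A, fun n hn => ?_⟩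
  have h1 : ‖((n : ℝ) ^ (k + 1))‖ ≤ ‖((2 : ℝ) ^ n)‖ := hn₁ n (le_of_max_le_left hn)
  rw [Real.norm_of_nonneg (by positivity), Real.norm_of_nonneg (by positivity)] at h1
  have h2 : n ^ (k + 1) ≤ 2 ^ n := by exact_mod_cast h1
  calc A * n ^ k ≤ n * n ^ k := Nat.mul_le_mul_right _ (le_of_max_le_right hn)
    _ = n ^ (k + 1) := by ring
    _ ≤ 2 ^ n := h2

/-- `p ^ 3 < 2 ^ p` for `p ≥ 10`. [folklore] -/
theorem pow_three_lt_two_pow {p : ℕ} (hp : 10 ≤ p) : p ^ 3 < 2 ^ p := by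
  induction p, hp using Nat.le_induction with
  | base => norm_num
  | succ p hp ih =>
    have h1 : 10 * p ^ 2 ≤ p ^ 3 := by
      calc 10 * p ^ 2 ≤ p * p ^ 2 := Nat.mul_le_mul_right _ hp
        _ = p ^ 3 := by ring
    have h2 : 3 * p ^ 2 + 3 * p + 1 ≤ 10 * p ^ 2 := by nlinarith
    calc (p + 1) ^ 3 = p ^ 3 + (3 * p ^ 2 + 3 * p + 1) := by ring
      _ ≤ p ^ 3 + p ^ 3 := by omega
      _ < 2 ^ p + 2 ^ p := by omega
      _ = 2 ^ (p + 1) := by ring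

/-- The dimension inequality of the count: `(p² (2n-1) + 1)^p < 2^(p²)` once `p ≥ 10` and
`p ≥ 2n` (`p² (2n-1) + 1 ≤ p³ < 2^p`). [folklore] -/
theorem key_ineq {p n : ℕ} (hp : 10 ≤ p) (hn : 2 * n ≤ p) :
    (p * p * (2 * n - 1) + 1) ^ p < 2 ^ (p * p) := by
  have h1 : p * p * (2 * n - 1) + 1 ≤ p ^ 3 := by
    have h : 2 * n - 1 ≤ p - 1 := by omega
    have hpp : 1 ≤ p * p := Nat.one_le_iff_ne_zero.mpr (by positivity)
    have hp1 : p - 1 + 1 = p := by omega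
    calc p * p * (2 * n - 1) + 1 ≤ p * p * (p - 1) + p * p :=
          add_le_add (Nat.mul_le_mul_left _ h) hpp
      _ = p * p * (p - 1 + 1) := by ring
      _ = p ^ 3 := by rw [hp1]; ring
  calc (p * p * (2 * n - 1) + 1) ^ p < (2 ^ p) ^ p :=
        Nat.pow_lt_pow_left (h1.trans_lt (pow_three_lt_two_pow hp)) (by omega)
    _ = 2 ^ (p * p) := by rw [← pow_mul]

/-- `2 ^ n ≤ C(2n, n)` for `n ≥ 4` (from `4^n < n · C(2n,n)` and `n ≤ 2^n`). [folklore] -/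
theorem two_pow_le_choose {n : ℕ} (hn : 4 ≤ n) : 2 ^ n ≤ Nat.choose (2 * n) n := by
  rw [← Nat.centralBinom_eq_two_mul_choose]
  by_contra hlt
  push Not at hlt
  have h1 := Nat.four_pow_lt_mul_centralBinom n hn
  have h2 : n ≤ 2 ^ n := Nat.lt_two_pow_self.le
  have h3 : n * Nat.centralBinom n ≤ 2 ^ n * Nat.centralBinom n := Nat.mul_le_mul_right _ h2
  have h4 : 2 ^ n * Nat.centralBinom n < 2 ^ n * 2 ^ n := (Nat.mul_lt_mul_left (by positivity)).mpr hlt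
  have h5 : 2 ^ n * 2 ^ n = 4 ^ n := by rw [← mul_pow]; norm_num
  omega


end LowDegreeEquations

/-- **Registered stub `stub_dimensionCount`** (crux stmt-ValiantsHypothesis-14610, line
`registered`; the generic dimension count behind `stub_lowDegreeEquations`, at universe `Type`):
a substitution of `#τ` variables by polynomials of degree `≤ δ` in `#υ` variables annihilates some
nonzero polynomial of total degree `≤ #τ` as soon as `(#τ δ + 1)^#υ < 2^#τ`. [folklore] -/
theorem stub_dimensionCount :
    ∀ (τ υ : Type) [Fintype τ] [Fintype υ] (h : τ → MvPolynomial υ ℂ) (δ : ℕ),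
      (∀ t, (h t).totalDegree ≤ δ) →
      (Fintype.card τ * δ + 1) ^ Fintype.card υ < 2 ^ Fintype.card τ →
      ∃ D : MvPolynomial τ ℂ, D ≠ 0 ∧ D.totalDegree ≤ Fintype.card τ ∧ MvPolynomial.aeval h D = 0 :=
  fun _ _ _ _ h _ hδ hcard => LowDegreeEquations.exists_ne_zero_aeval_eq_zero h hδ hcard

end Summit.ValiantsHypothesis.ValiantsHypothesis.Theorems.BarrierLever.SuccinctHittingSetsForVP
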